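import Mathlib
import Summits.NavierStokesRegularity.NavierStokesRegularity.Theorems.FilamentSkeletonRssKelvinGateFreeResolvent

/-!
# Route `FilamentSkeletonRss` · crux `TransverseReduction1A` (stmt-27414; successor of the aside `TransverseReductionRJ`,
# stmt-21221) — line `kelvin_gate`: the free resolvent `W = ∫₀^∞ W_s ds` of CONTINUOUS data under ABSTRACT slice dominations

Helper file (theorems only, `--as helper`).  HONEST FRAMING: analysis bookkeeping for a HYPOTHETICAL filament-type rotating
self-similar blow-up route; nothing here bears on Navier–Stokes regularity; no stub is proved here.

`…KelvinGateFreeResolventSmooth` / `…KelvinGateFreeResolvent` differentiate the Laplace integral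
`W(y) = ∫₀^∞ W_s(y) ds`, `W_s(y) = (e^{-s/2} R_{−αs}) (e^{(1 − e^{-s})Δ} F)(e^{-s/2} R_{αs} y)`, under the integral sign and prove
`𝓛_(α,0) W = F` for `F ∈ C¹` bounded with bounded derivative, using the dominations `‖DW_s‖ ≤ C₁e^{-s}`,
`‖D²W_s‖ ≤ 2^{3/2}C₁ s^{-1/2}e^{-s}` that come from the derivative falling on the datum.  The sharp-scale free Kelvin gate
(design memo SHARP-WEIGHTS-DESIGN-21221-g7) runs the same assembly on the PROJECTED datum `G = F − ∇Q`, which is only continuous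
(bounded, with a weighted local Hölder modulus).  This file re-proves the assembly for bounded continuous `F` under ABSTRACT
dominations — integrable functions `b₁`, `b₂` on `(0, ∞)` with `‖DW_s(y)‖ ≤ b₁(s)`, `‖D²W_s(y)‖ ≤ b₂(s)` for all `y` and `s > 0`:

* `hasFDerivAt_freeResolvent_of_dominated`, `hasFDerivAt_fderiv_freeResolvent_of_dominated`,
  `continuous_fderiv_fderiv_freeResolvent_of_dominated`, `contDiff_two_freeResolvent_of_dominated` — `W ∈ C²` with
  `DW = ∫₀^∞ DW_s`, `D²W = ∫₀^∞ D²W_s`;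
* `integral_lerayLin_freeSlice_of_dominated` — `∫₀^∞ 𝓛_(α,0) W_s (y) ds = F(y)` (FTC on `(0, ∞)`: `∂_s W_s = −𝓛 W_s`,
  `W_s → F` at `0⁺`, `W_s → 0` at `∞` — these need bounded continuous data only);
* `lerayLin_freeResolvent_of_dominated`, `lerayLin_freeResolvent_eq_of_dominated` — **`𝓛_(α,0) W = F`** pointwise.

The `C¹` case of the earlier files is the instance `b₁ = C₁e^{-s}`, `b₂ = 2^{3/2}C₁ s^{-1/2}e^{-s}`; the Hölder-data instance is the
next file of the line.
-/

set_option linter.dupNamespace false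

noncomputable section

namespace Summit.NavierStokesRegularity.NavierStokesRegularity.Theorems.KelvinGate

open Set Function Filter Topology InnerProductSpace MeasureTheory Real Metric
open Literature.Analysis.FluidPDE Literature.Analysis.UnboundedOperators
open scoped Laplacian RealInnerProductSpace ContDiff Topology ENNReal BigOperators

section Dominated

variable {F : EuclideanSpace ℝ (Fin 3) → EuclideanSpace ℝ (Fin 3)} {C₀ : ℝ} {α : ℝ} {b₁ b₂ : ℝ → ℝ}

/-! ## Differentiation under the integral sign -/

/-- `s ↦ DW_s(y)` is integrable on `(0, ∞)` (dominated by `b₁`). -/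
theorem integrableOn_fderiv_freeSlice_of_dominated (hF : Continuous F) (h0 : ∀ z, ‖F z‖ ≤ C₀)
    (hb₁ : IntegrableOn b₁ (Ioi 0))
    (hD1 : ∀ s, 0 < s → ∀ y, ‖fderiv ℝ (fun z => (Real.exp (-(s / 2)) • rotZL (-(α * s)))
        (heatExtension F (1 - Real.exp (-s)) ((Real.exp (-(s / 2)) • rotZL (α * s)) z))) y‖ ≤ b₁ s)
    (y : EuclideanSpace ℝ (Fin 3)) :
    IntegrableOn (fun s : ℝ => fderiv ℝ (fun z => (Real.exp (-(s / 2)) • rotZL (-(α * s)))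
        (heatExtension F (1 - Real.exp (-s)) ((Real.exp (-(s / 2)) • rotZL (α * s)) z))) y) (Ioi 0) := by
  refine Integrable.mono' hb₁ ?_ ?_
  · exact (continuousOn_fderiv_freeSlice hF h0 α y).aestronglyMeasurable measurableSet_Ioi
  · exact (ae_restrict_iff' measurableSet_Ioi).2 (Eventually.of_forall fun s hs => hD1 s hs y)

/-- **First derivative of the free resolvent** under an abstract domination: `D(∫₀^∞ W_s ds)(y) = ∫₀^∞ DW_s(y) ds`. -/
theorem hasFDerivAt_freeResolvent_of_dominated (hF : Continuous F) (h0 : ∀ z, ‖F z‖ ≤ C₀)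
    (hb₁ : IntegrableOn b₁ (Ioi 0))
    (hD1 : ∀ s, 0 < s → ∀ y, ‖fderiv ℝ (fun z => (Real.exp (-(s / 2)) • rotZL (-(α * s)))
        (heatExtension F (1 - Real.exp (-s)) ((Real.exp (-(s / 2)) • rotZL (α * s)) z))) y‖ ≤ b₁ s)
    (y₀ : EuclideanSpace ℝ (Fin 3)) :
    HasFDerivAt (fun y => ∫ s in Ioi (0:ℝ), (Real.exp (-(s / 2)) • rotZL (-(α * s)))
        (heatExtension F (1 - Real.exp (-s)) ((Real.exp (-(s / 2)) • rotZL (α * s)) y)))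
      (∫ s in Ioi (0:ℝ), fderiv ℝ (fun z => (Real.exp (-(s / 2)) • rotZL (-(α * s)))
        (heatExtension F (1 - Real.exp (-s)) ((Real.exp (-(s / 2)) • rotZL (α * s)) z))) y₀) y₀ := by
  refine hasFDerivAt_integral_of_dominated_of_fderiv_le (𝕜 := ℝ) (μ := volume.restrict (Ioi (0:ℝ)))
    (F := fun y s => (Real.exp (-(s / 2)) • rotZL (-(α * s)))
        (heatExtension F (1 - Real.exp (-s)) ((Real.exp (-(s / 2)) • rotZL (α * s)) y)))
    (F' := fun y s => fderiv ℝ (fun z => (Real.exp (-(s / 2)) • rotZL (-(α * s)))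
        (heatExtension F (1 - Real.exp (-s)) ((Real.exp (-(s / 2)) • rotZL (α * s)) z))) y)
    (bound := b₁) (ball_mem_nhds y₀ zero_lt_one) ?_ ?_ ?_ ?_ hb₁ ?_
  · exact Eventually.of_forall fun y => (continuousOn_freeSlice hF h0 α y).aestronglyMeasurable measurableSet_Ioi
  · exact integrableOn_freeSlice hF h0 α y₀
  · exact (continuousOn_fderiv_freeSlice hF h0 α y₀).aestronglyMeasurable measurableSet_Ioi
  · exact (ae_restrict_iff' measurableSet_Ioi).2 (Eventually.of_forall fun s hs y _ => hD1 s hs y)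
  · exact (ae_restrict_iff' measurableSet_Ioi).2 (Eventually.of_forall fun s hs y _ =>
      (hasFDerivAt_freeSlice_space hF h0 α hs y).differentiableAt.hasFDerivAt)

/-- **Second derivative of the free resolvent** under abstract dominations: `D(∫₀^∞ DW_s ds)(y) = ∫₀^∞ D²W_s(y) ds`. -/
theorem hasFDerivAt_fderiv_freeResolvent_of_dominated (hF : Continuous F) (h0 : ∀ z, ‖F z‖ ≤ C₀)
    (hb₁ : IntegrableOn b₁ (Ioi 0))
    (hD1 : ∀ s, 0 < s → ∀ y, ‖fderiv ℝ (fun z => (Real.exp (-(s / 2)) • rotZL (-(α * s)))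
        (heatExtension F (1 - Real.exp (-s)) ((Real.exp (-(s / 2)) • rotZL (α * s)) z))) y‖ ≤ b₁ s)
    (hb₂ : IntegrableOn b₂ (Ioi 0))
    (hD2 : ∀ s, 0 < s → ∀ y, ‖fderiv ℝ (fun z => fderiv ℝ (fun z => (Real.exp (-(s / 2)) • rotZL (-(α * s)))
        (heatExtension F (1 - Real.exp (-s)) ((Real.exp (-(s / 2)) • rotZL (α * s)) z))) z) y‖ ≤ b₂ s)
    (y₀ : EuclideanSpace ℝ (Fin 3)) :
    HasFDerivAt (fun y => ∫ s in Ioi (0:ℝ), fderiv ℝ (fun z => (Real.exp (-(s / 2)) • rotZL (-(α * s)))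
        (heatExtension F (1 - Real.exp (-s)) ((Real.exp (-(s / 2)) • rotZL (α * s)) z))) y)
      (∫ s in Ioi (0:ℝ), fderiv ℝ (fun z => fderiv ℝ (fun z => (Real.exp (-(s / 2)) • rotZL (-(α * s)))
        (heatExtension F (1 - Real.exp (-s)) ((Real.exp (-(s / 2)) • rotZL (α * s)) z))) z) y₀) y₀ := by
  refine hasFDerivAt_integral_of_dominated_of_fderiv_le (𝕜 := ℝ) (μ := volume.restrict (Ioi (0:ℝ)))
    (F := fun y s => fderiv ℝ (fun z => (Real.exp (-(s / 2)) • rotZL (-(α * s)))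
        (heatExtension F (1 - Real.exp (-s)) ((Real.exp (-(s / 2)) • rotZL (α * s)) z))) y)
    (F' := fun y s => fderiv ℝ (fun z => fderiv ℝ (fun z => (Real.exp (-(s / 2)) • rotZL (-(α * s)))
        (heatExtension F (1 - Real.exp (-s)) ((Real.exp (-(s / 2)) • rotZL (α * s)) z))) z) y)
    (bound := b₂) (ball_mem_nhds y₀ zero_lt_one) ?_ ?_ ?_ ?_ hb₂ ?_
  · exact Eventually.of_forall fun y =>
      (continuousOn_fderiv_freeSlice hF h0 α y).aestronglyMeasurable measurableSet_Ioi
  · exact integrableOn_fderiv_freeSlice_of_dominated hF h0 hb₁ hD1 y₀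
  · exact (continuousOn_fderiv_fderiv_freeSlice hF h0 α y₀).aestronglyMeasurable measurableSet_Ioi
  · exact (ae_restrict_iff' measurableSet_Ioi).2 (Eventually.of_forall fun s hs y _ => hD2 s hs y)
  · exact (ae_restrict_iff' measurableSet_Ioi).2 (Eventually.of_forall fun s hs y _ =>
      (hasFDerivAt_fderiv_freeSlice hF h0 α hs y).differentiableAt.hasFDerivAt)

/-- The second derivative `y ↦ ∫₀^∞ D²W_s(y) ds` is continuous (dominated convergence; each `W_s` is smooth). -/
theorem continuous_fderiv_fderiv_freeResolvent_of_dominated (hF : Continuous F) (h0 : ∀ z, ‖F z‖ ≤ C₀)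
    (hb₂ : IntegrableOn b₂ (Ioi 0))
    (hD2 : ∀ s, 0 < s → ∀ y, ‖fderiv ℝ (fun z => fderiv ℝ (fun z => (Real.exp (-(s / 2)) • rotZL (-(α * s)))
        (heatExtension F (1 - Real.exp (-s)) ((Real.exp (-(s / 2)) • rotZL (α * s)) z))) z) y‖ ≤ b₂ s) :
    Continuous fun y => ∫ s in Ioi (0:ℝ), fderiv ℝ (fun z => fderiv ℝ (fun z => (Real.exp (-(s / 2)) • rotZL (-(α * s)))
        (heatExtension F (1 - Real.exp (-s)) ((Real.exp (-(s / 2)) • rotZL (α * s)) z))) z) y := by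
  refine continuous_of_dominated (μ := volume.restrict (Ioi (0:ℝ))) (bound := b₂) ?_ ?_ hb₂ ?_
  · exact fun y => (continuousOn_fderiv_fderiv_freeSlice hF h0 α y).aestronglyMeasurable measurableSet_Ioi
  · exact fun y => (ae_restrict_iff' measurableSet_Ioi).2 (Eventually.of_forall fun s hs => hD2 s hs y)
  · refine (ae_restrict_iff' measurableSet_Ioi).2 (Eventually.of_forall fun s hs => ?_)
    have hsm : ContDiff ℝ 2 (fun z => (Real.exp (-(s / 2)) • rotZL (-(α * s)))
        (heatExtension F (1 - Real.exp (-s)) ((Real.exp (-(s / 2)) • rotZL (α * s)) z))) :=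
      (Real.exp (-(s / 2)) • rotZL (-(α * s))).contDiff.comp
        ((contDiff_heatExtension_of_bound hF h0 (heatTime_mem_Ioc hs).1).comp
          (Real.exp (-(s / 2)) • rotZL (α * s)).contDiff)
    exact (hsm.fderiv_right (m := 1) le_rfl).continuous_fderiv one_ne_zero

/-- **The free resolvent of dominated continuous data is `C²`.** -/
theorem contDiff_two_freeResolvent_of_dominated (hF : Continuous F) (h0 : ∀ z, ‖F z‖ ≤ C₀)
    (hb₁ : IntegrableOn b₁ (Ioi 0))
    (hD1 : ∀ s, 0 < s → ∀ y, ‖fderiv ℝ (fun z => (Real.exp (-(s / 2)) • rotZL (-(α * s)))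
        (heatExtension F (1 - Real.exp (-s)) ((Real.exp (-(s / 2)) • rotZL (α * s)) z))) y‖ ≤ b₁ s)
    (hb₂ : IntegrableOn b₂ (Ioi 0))
    (hD2 : ∀ s, 0 < s → ∀ y, ‖fderiv ℝ (fun z => fderiv ℝ (fun z => (Real.exp (-(s / 2)) • rotZL (-(α * s)))
        (heatExtension F (1 - Real.exp (-s)) ((Real.exp (-(s / 2)) • rotZL (α * s)) z))) z) y‖ ≤ b₂ s) :
    ContDiff ℝ 2 (fun y => ∫ s in Ioi (0:ℝ), (Real.exp (-(s / 2)) • rotZL (-(α * s)))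
        (heatExtension F (1 - Real.exp (-s)) ((Real.exp (-(s / 2)) • rotZL (α * s)) y))) := by
  have h2 : ContDiff ℝ 1 (fun y => ∫ s in Ioi (0:ℝ), fderiv ℝ (fun z => (Real.exp (-(s / 2)) • rotZL (-(α * s)))
        (heatExtension F (1 - Real.exp (-s)) ((Real.exp (-(s / 2)) • rotZL (α * s)) z))) y) :=
    contDiff_one_iff_hasFDerivAt.2 ⟨_, continuous_fderiv_fderiv_freeResolvent_of_dominated hF h0 hb₂ hD2,
      fun y => hasFDerivAt_fderiv_freeResolvent_of_dominated hF h0 hb₁ hD1 hb₂ hD2 y⟩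
  have h : ContDiff ℝ ((1 : ℕ) + 1 : ℕ) (fun y => ∫ s in Ioi (0:ℝ), (Real.exp (-(s / 2)) • rotZL (-(α * s)))
        (heatExtension F (1 - Real.exp (-s)) ((Real.exp (-(s / 2)) • rotZL (α * s)) y))) :=
    contDiff_succ_iff_hasFDerivAt.2 ⟨_, h2, fun y => hasFDerivAt_freeResolvent_of_dominated hF h0 hb₁ hD1 y⟩
  exact h

/-! ## The equation `𝓛_(α,0) W = F` -/

/-- `s ↦ D²W_s(y)[v][w]` is integrable on `(0, ∞)` for fixed vectors `v, w` (dominated by `b₂ ‖v‖ ‖w‖`). -/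
theorem integrableOn_fderiv_fderiv_freeSlice_apply_of_dominated (hF : Continuous F) (h0 : ∀ z, ‖F z‖ ≤ C₀)
    (hb₂ : IntegrableOn b₂ (Ioi 0))
    (hD2 : ∀ s, 0 < s → ∀ y, ‖fderiv ℝ (fun z => fderiv ℝ (fun z => (Real.exp (-(s / 2)) • rotZL (-(α * s)))
        (heatExtension F (1 - Real.exp (-s)) ((Real.exp (-(s / 2)) • rotZL (α * s)) z))) z) y‖ ≤ b₂ s)
    (y v w : EuclideanSpace ℝ (Fin 3)) :
    IntegrableOn (fun s : ℝ => fderiv ℝ (fun z => fderiv ℝ (fun z => (Real.exp (-(s / 2)) • rotZL (-(α * s)))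
        (heatExtension F (1 - Real.exp (-s)) ((Real.exp (-(s / 2)) • rotZL (α * s)) z))) z) y v w) (Ioi 0) := by
  refine Integrable.mono' ((hb₂.mul_const ‖v‖).mul_const ‖w‖) ?_ ?_
  · exact (((continuousOn_fderiv_fderiv_freeSlice hF h0 α y).clm_apply continuousOn_const).clm_apply
      continuousOn_const).aestronglyMeasurable measurableSet_Ioi
  · refine (ae_restrict_iff' measurableSet_Ioi).2 (Eventually.of_forall fun s hs => ?_)
    calc _ ≤ ‖fderiv ℝ (fun z => fderiv ℝ (fun z => (Real.exp (-(s / 2)) • rotZL (-(α * s)))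
            (heatExtension F (1 - Real.exp (-s)) ((Real.exp (-(s / 2)) • rotZL (α * s)) z))) z) y v‖ * ‖w‖ :=
          ContinuousLinearMap.le_opNorm _ _
      _ ≤ ‖fderiv ℝ (fun z => fderiv ℝ (fun z => (Real.exp (-(s / 2)) • rotZL (-(α * s)))
            (heatExtension F (1 - Real.exp (-s)) ((Real.exp (-(s / 2)) • rotZL (α * s)) z))) z) y‖ * ‖v‖ * ‖w‖ :=
          mul_le_mul_of_nonneg_right (ContinuousLinearMap.le_opNorm _ _) (norm_nonneg _)
      _ ≤ b₂ s * ‖v‖ * ‖w‖ := by gcongr; exact hD2 s hs y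

/-- `s ↦ 𝓛_(α,0) W_s (y)` is integrable on `(0, ∞)`. -/
theorem integrableOn_lerayLin_freeSlice_of_dominated (hF : Continuous F) (h0 : ∀ z, ‖F z‖ ≤ C₀)
    (hb₁ : IntegrableOn b₁ (Ioi 0))
    (hD1 : ∀ s, 0 < s → ∀ y, ‖fderiv ℝ (fun z => (Real.exp (-(s / 2)) • rotZL (-(α * s)))
        (heatExtension F (1 - Real.exp (-s)) ((Real.exp (-(s / 2)) • rotZL (α * s)) z))) y‖ ≤ b₁ s)
    (hb₂ : IntegrableOn b₂ (Ioi 0))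
    (hD2 : ∀ s, 0 < s → ∀ y, ‖fderiv ℝ (fun z => fderiv ℝ (fun z => (Real.exp (-(s / 2)) • rotZL (-(α * s)))
        (heatExtension F (1 - Real.exp (-s)) ((Real.exp (-(s / 2)) • rotZL (α * s)) z))) z) y‖ ≤ b₂ s)
    (y : EuclideanSpace ℝ (Fin 3)) :
    IntegrableOn (fun s : ℝ => lerayLin α (fun _ => 0) (fun z => (Real.exp (-(s / 2)) • rotZL (-(α * s)))
        (heatExtension F (1 - Real.exp (-s)) ((Real.exp (-(s / 2)) • rotZL (α * s)) z))) y) (Ioi 0) := by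
  have hV := integrableOn_freeSlice hF h0 α y
  have hD := integrableOn_fderiv_freeSlice_of_dominated hF h0 hb₁ hD1 y
  have hJV : IntegrableOn (fun s : ℝ => rotGenL ((Real.exp (-(s / 2)) • rotZL (-(α * s)))
      (heatExtension F (1 - Real.exp (-s)) ((Real.exp (-(s / 2)) • rotZL (α * s)) y)))) (Ioi 0) :=
    ContinuousLinearMap.integrable_comp rotGenL hV
  have hDv : ∀ v : EuclideanSpace ℝ (Fin 3), IntegrableOn (fun s : ℝ => fderiv ℝ (fun z => (Real.exp (-(s / 2)) • rotZL (-(α * s)))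
      (heatExtension F (1 - Real.exp (-s)) ((Real.exp (-(s / 2)) • rotZL (α * s)) z))) y v) (Ioi 0) := fun v =>
    (ContinuousLinearMap.apply ℝ (EuclideanSpace ℝ (Fin 3)) v).integrable_comp hD
  have hΔ : IntegrableOn (fun s : ℝ => ∑ i : Fin 3, fderiv ℝ (fderiv ℝ (fun z => (Real.exp (-(s / 2)) • rotZL (-(α * s)))
      (heatExtension F (1 - Real.exp (-s)) ((Real.exp (-(s / 2)) • rotZL (α * s)) z)))) y
        (EuclideanSpace.basisFun (Fin 3) ℝ i) (EuclideanSpace.basisFun (Fin 3) ℝ i)) (Ioi 0) :=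
    integrable_finsetSum _ fun i _ => integrableOn_fderiv_fderiv_freeSlice_apply_of_dominated hF h0 hb₂ hD2 y _ _
  have h := ((((hJV.sub (hDv (rotGenL y))).smul α).add (hV.smul (1/2:ℝ))).add ((hDv y).smul (1/2:ℝ))).sub hΔ
  refine h.congr ((ae_restrict_iff' measurableSet_Ioi).2 (Eventually.of_forall fun s _ => ?_))
  simp only [lerayLin_zero_base_eq, Pi.add_apply, Pi.sub_apply, Pi.smul_apply]

/-- **`∫₀^∞ 𝓛_(α,0) W_s (y) ds = F(y)`** for bounded continuous `F` under the abstract dominations: the fundamental theorem of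
calculus on `(0, ∞)` for `s ↦ W_s(y)` (derivative `−𝓛 W_s(y)`, boundary values `F(y)` at `0⁺` and `0` at `∞`). -/
theorem integral_lerayLin_freeSlice_of_dominated (hF : Continuous F) (h0 : ∀ z, ‖F z‖ ≤ C₀)
    (hb₁ : IntegrableOn b₁ (Ioi 0))
    (hD1 : ∀ s, 0 < s → ∀ y, ‖fderiv ℝ (fun z => (Real.exp (-(s / 2)) • rotZL (-(α * s)))
        (heatExtension F (1 - Real.exp (-s)) ((Real.exp (-(s / 2)) • rotZL (α * s)) z))) y‖ ≤ b₁ s)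
    (hb₂ : IntegrableOn b₂ (Ioi 0))
    (hD2 : ∀ s, 0 < s → ∀ y, ‖fderiv ℝ (fun z => fderiv ℝ (fun z => (Real.exp (-(s / 2)) • rotZL (-(α * s)))
        (heatExtension F (1 - Real.exp (-s)) ((Real.exp (-(s / 2)) • rotZL (α * s)) z))) z) y‖ ≤ b₂ s)
    (y : EuclideanSpace ℝ (Fin 3)) :
    ∫ s in Ioi (0:ℝ), lerayLin α (fun _ => 0) (fun z => (Real.exp (-(s / 2)) • rotZL (-(α * s)))
        (heatExtension F (1 - Real.exp (-s)) ((Real.exp (-(s / 2)) • rotZL (α * s)) z))) y = F y := by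
  set f : ℝ → EuclideanSpace ℝ (Fin 3) := fun s => (Real.exp (-(s / 2)) • rotZL (-(α * s)))
      (heatExtension F (1 - Real.exp (-s)) ((Real.exp (-(s / 2)) • rotZL (α * s)) y)) with hf
  set g : ℝ → EuclideanSpace ℝ (Fin 3) := Function.update f 0 (F y) with hg
  have hgf : ∀ {s : ℝ}, 0 < s → g s = f s := fun hs => by rw [hg, Function.update_of_ne (ne_of_gt hs)]
  have hg0 : g 0 = F y := by rw [hg, Function.update_self]
  have hcont : ContinuousWithinAt g (Ici 0) 0 := by
    rw [← continuousWithinAt_Ioi_iff_Ici, ContinuousWithinAt, hg0]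
    refine (tendsto_freeSlice_zero hF h0 α y).congr' ?_
    filter_upwards [self_mem_nhdsWithin] with s hs
    exact (hgf hs).symm
  have hderiv : ∀ s ∈ Ioi (0:ℝ), HasDerivAt g (-(lerayLin α (fun _ => 0) (fun z => (Real.exp (-(s / 2)) • rotZL (-(α * s)))
        (heatExtension F (1 - Real.exp (-s)) ((Real.exp (-(s / 2)) • rotZL (α * s)) z))) y)) s := by
    intro s hs
    refine (hasDerivAt_freeSlice hF h0 α hs y).congr_of_eventuallyEq ?_
    filter_upwards [eventually_ne_nhds (ne_of_gt hs)] with t ht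
    rw [hg, Function.update_of_ne ht]
  have hlim : Tendsto g atTop (𝓝 0) := by
    refine (tendsto_freeSlice_atTop h0 α y).congr' ?_
    filter_upwards [eventually_gt_atTop (0:ℝ)] with s hs
    exact (hgf hs).symm
  have hint := (integrableOn_lerayLin_freeSlice_of_dominated hF h0 hb₁ hD1 hb₂ hD2 y).neg
  have hFTC := integral_Ioi_of_hasDerivAt_of_tendsto hcont hderiv hint hlim
  rw [integral_neg, hg0, zero_sub, neg_inj] at hFTC
  exact hFTC

/-- **`𝓛_(α,0) (∫₀^∞ W_s ds)(y) = ∫₀^∞ 𝓛_(α,0) W_s (y) ds`** under the abstract dominations (the value, the derivative and the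
second derivative of the resolvent are the integrals of those of the slices, and `𝓛_(α,0)` is linear in them). -/
theorem lerayLin_freeResolvent_of_dominated (hF : Continuous F) (h0 : ∀ z, ‖F z‖ ≤ C₀)
    (hb₁ : IntegrableOn b₁ (Ioi 0))
    (hD1 : ∀ s, 0 < s → ∀ y, ‖fderiv ℝ (fun z => (Real.exp (-(s / 2)) • rotZL (-(α * s)))
        (heatExtension F (1 - Real.exp (-s)) ((Real.exp (-(s / 2)) • rotZL (α * s)) z))) y‖ ≤ b₁ s)
    (hb₂ : IntegrableOn b₂ (Ioi 0))
    (hD2 : ∀ s, 0 < s → ∀ y, ‖fderiv ℝ (fun z => fderiv ℝ (fun z => (Real.exp (-(s / 2)) • rotZL (-(α * s)))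
        (heatExtension F (1 - Real.exp (-s)) ((Real.exp (-(s / 2)) • rotZL (α * s)) z))) z) y‖ ≤ b₂ s)
    (y : EuclideanSpace ℝ (Fin 3)) :
    lerayLin α (fun _ => 0) (fun y => ∫ s in Ioi (0:ℝ), (Real.exp (-(s / 2)) • rotZL (-(α * s)))
        (heatExtension F (1 - Real.exp (-s)) ((Real.exp (-(s / 2)) • rotZL (α * s)) y))) y =
      ∫ s in Ioi (0:ℝ), lerayLin α (fun _ => 0) (fun z => (Real.exp (-(s / 2)) • rotZL (-(α * s)))
        (heatExtension F (1 - Real.exp (-s)) ((Real.exp (-(s / 2)) • rotZL (α * s)) z))) y := by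
  -- the derivatives of the resolvent
  have hD1f : fderiv ℝ (fun y => ∫ s in Ioi (0:ℝ), (Real.exp (-(s / 2)) • rotZL (-(α * s)))
        (heatExtension F (1 - Real.exp (-s)) ((Real.exp (-(s / 2)) • rotZL (α * s)) y))) =
      fun y => ∫ s in Ioi (0:ℝ), fderiv ℝ (fun z => (Real.exp (-(s / 2)) • rotZL (-(α * s)))
        (heatExtension F (1 - Real.exp (-s)) ((Real.exp (-(s / 2)) • rotZL (α * s)) z))) y :=
    funext fun y => (hasFDerivAt_freeResolvent_of_dominated hF h0 hb₁ hD1 y).fderiv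
  have hD2f : fderiv ℝ (fderiv ℝ (fun y => ∫ s in Ioi (0:ℝ), (Real.exp (-(s / 2)) • rotZL (-(α * s)))
        (heatExtension F (1 - Real.exp (-s)) ((Real.exp (-(s / 2)) • rotZL (α * s)) y)))) y =
      ∫ s in Ioi (0:ℝ), fderiv ℝ (fun z => fderiv ℝ (fun z => (Real.exp (-(s / 2)) • rotZL (-(α * s)))
        (heatExtension F (1 - Real.exp (-s)) ((Real.exp (-(s / 2)) • rotZL (α * s)) z))) z) y := by
    rw [hD1f]
    exact (hasFDerivAt_fderiv_freeResolvent_of_dominated hF h0 hb₁ hD1 hb₂ hD2 y).fderiv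
  -- integrability of the pieces
  have hV := integrableOn_freeSlice hF h0 α y
  have hD := integrableOn_fderiv_freeSlice_of_dominated hF h0 hb₁ hD1 y
  have hJV : IntegrableOn (fun s : ℝ => rotGenL ((Real.exp (-(s / 2)) • rotZL (-(α * s)))
      (heatExtension F (1 - Real.exp (-s)) ((Real.exp (-(s / 2)) • rotZL (α * s)) y)))) (Ioi 0) :=
    ContinuousLinearMap.integrable_comp rotGenL hV
  have hDv : ∀ v : EuclideanSpace ℝ (Fin 3), IntegrableOn (fun s : ℝ => fderiv ℝ (fun z => (Real.exp (-(s / 2)) • rotZL (-(α * s)))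
      (heatExtension F (1 - Real.exp (-s)) ((Real.exp (-(s / 2)) • rotZL (α * s)) z))) y v) (Ioi 0) := fun v =>
    (ContinuousLinearMap.apply ℝ (EuclideanSpace ℝ (Fin 3)) v).integrable_comp hD
  have hD2i : ∀ i : Fin 3, IntegrableOn (fun s : ℝ => fderiv ℝ (fderiv ℝ (fun z => (Real.exp (-(s / 2)) • rotZL (-(α * s)))
      (heatExtension F (1 - Real.exp (-s)) ((Real.exp (-(s / 2)) • rotZL (α * s)) z)))) y
        (EuclideanSpace.basisFun (Fin 3) ℝ i) (EuclideanSpace.basisFun (Fin 3) ℝ i)) (Ioi 0) := fun i =>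
    integrableOn_fderiv_fderiv_freeSlice_apply_of_dominated hF h0 hb₂ hD2 y _ _
  have hΔ := integrable_finsetSum (Finset.univ : Finset (Fin 3)) fun i _ => hD2i i
  -- the second derivative applied to `(e_i, e_i)` under the integral
  have hD2apply : ∀ i : Fin 3, fderiv ℝ (fderiv ℝ (fun y => ∫ s in Ioi (0:ℝ), (Real.exp (-(s / 2)) • rotZL (-(α * s)))
        (heatExtension F (1 - Real.exp (-s)) ((Real.exp (-(s / 2)) • rotZL (α * s)) y)))) y
        (EuclideanSpace.basisFun (Fin 3) ℝ i) (EuclideanSpace.basisFun (Fin 3) ℝ i) =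
      ∫ s in Ioi (0:ℝ), fderiv ℝ (fderiv ℝ (fun z => (Real.exp (-(s / 2)) • rotZL (-(α * s)))
        (heatExtension F (1 - Real.exp (-s)) ((Real.exp (-(s / 2)) • rotZL (α * s)) z)))) y
          (EuclideanSpace.basisFun (Fin 3) ℝ i) (EuclideanSpace.basisFun (Fin 3) ℝ i) := by
    intro i
    rw [hD2f]
    rw [ContinuousLinearMap.integral_apply ?hI2, ContinuousLinearMap.integral_apply ?hI1]
    case hI2 =>
      refine Integrable.mono' hb₂ ?_ ?_
      · exact (continuousOn_fderiv_fderiv_freeSlice hF h0 α y).aestronglyMeasurable measurableSet_Ioi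
      · exact (ae_restrict_iff' measurableSet_Ioi).2 (Eventually.of_forall fun s hs => hD2 s hs y)
    case hI1 =>
      refine Integrable.mono' (hb₂.mul_const ‖EuclideanSpace.basisFun (Fin 3) ℝ i‖) ?_ ?_
      · exact ((continuousOn_fderiv_fderiv_freeSlice hF h0 α y).clm_apply continuousOn_const).aestronglyMeasurable
          measurableSet_Ioi
      · refine (ae_restrict_iff' measurableSet_Ioi).2 (Eventually.of_forall fun s hs => ?_)
        exact (ContinuousLinearMap.le_opNorm _ _).trans (mul_le_mul_of_nonneg_right (hD2 s hs y) (norm_nonneg _))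
  -- assemble: the right-hand side, integrated term by term
  have key : (∫ s in Ioi (0:ℝ), lerayLin α (fun _ => 0) (fun z => (Real.exp (-(s / 2)) • rotZL (-(α * s)))
        (heatExtension F (1 - Real.exp (-s)) ((Real.exp (-(s / 2)) • rotZL (α * s)) z))) y) =
      α • ((∫ s in Ioi (0:ℝ), rotGenL ((Real.exp (-(s / 2)) • rotZL (-(α * s)))
          (heatExtension F (1 - Real.exp (-s)) ((Real.exp (-(s / 2)) • rotZL (α * s)) y)))) -
        ∫ s in Ioi (0:ℝ), fderiv ℝ (fun z => (Real.exp (-(s / 2)) • rotZL (-(α * s)))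
          (heatExtension F (1 - Real.exp (-s)) ((Real.exp (-(s / 2)) • rotZL (α * s)) z))) y (rotGenL y)) +
      (1/2:ℝ) • (∫ s in Ioi (0:ℝ), (Real.exp (-(s / 2)) • rotZL (-(α * s)))
          (heatExtension F (1 - Real.exp (-s)) ((Real.exp (-(s / 2)) • rotZL (α * s)) y))) +
      (1/2:ℝ) • (∫ s in Ioi (0:ℝ), fderiv ℝ (fun z => (Real.exp (-(s / 2)) • rotZL (-(α * s)))
          (heatExtension F (1 - Real.exp (-s)) ((Real.exp (-(s / 2)) • rotZL (α * s)) z))) y y) -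
      ∑ i : Fin 3, ∫ s in Ioi (0:ℝ), fderiv ℝ (fderiv ℝ (fun z => (Real.exp (-(s / 2)) • rotZL (-(α * s)))
          (heatExtension F (1 - Real.exp (-s)) ((Real.exp (-(s / 2)) • rotZL (α * s)) z)))) y
            (EuclideanSpace.basisFun (Fin 3) ℝ i) (EuclideanSpace.basisFun (Fin 3) ℝ i) := by
    have hint : (fun s : ℝ => lerayLin α (fun _ => 0) (fun z => (Real.exp (-(s / 2)) • rotZL (-(α * s)))
        (heatExtension F (1 - Real.exp (-s)) ((Real.exp (-(s / 2)) • rotZL (α * s)) z))) y) =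
      fun s => α • (rotGenL ((Real.exp (-(s / 2)) • rotZL (-(α * s)))
          (heatExtension F (1 - Real.exp (-s)) ((Real.exp (-(s / 2)) • rotZL (α * s)) y))) -
        fderiv ℝ (fun z => (Real.exp (-(s / 2)) • rotZL (-(α * s)))
          (heatExtension F (1 - Real.exp (-s)) ((Real.exp (-(s / 2)) • rotZL (α * s)) z))) y (rotGenL y)) +
      (1/2:ℝ) • (Real.exp (-(s / 2)) • rotZL (-(α * s)))
          (heatExtension F (1 - Real.exp (-s)) ((Real.exp (-(s / 2)) • rotZL (α * s)) y)) +
      (1/2:ℝ) • fderiv ℝ (fun z => (Real.exp (-(s / 2)) • rotZL (-(α * s)))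
          (heatExtension F (1 - Real.exp (-s)) ((Real.exp (-(s / 2)) • rotZL (α * s)) z))) y y -
      ∑ i : Fin 3, fderiv ℝ (fderiv ℝ (fun z => (Real.exp (-(s / 2)) • rotZL (-(α * s)))
          (heatExtension F (1 - Real.exp (-s)) ((Real.exp (-(s / 2)) • rotZL (α * s)) z)))) y
            (EuclideanSpace.basisFun (Fin 3) ℝ i) (EuclideanSpace.basisFun (Fin 3) ℝ i) :=
      funext fun s => lerayLin_zero_base_eq α _ y
    have hA1 : Integrable (fun s : ℝ => α • (rotGenL ((Real.exp (-(s / 2)) • rotZL (-(α * s)))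
          (heatExtension F (1 - Real.exp (-s)) ((Real.exp (-(s / 2)) • rotZL (α * s)) y))) -
        fderiv ℝ (fun z => (Real.exp (-(s / 2)) • rotZL (-(α * s)))
          (heatExtension F (1 - Real.exp (-s)) ((Real.exp (-(s / 2)) • rotZL (α * s)) z))) y (rotGenL y)))
        (volume.restrict (Ioi (0:ℝ))) := (hJV.sub (hDv (rotGenL y))).smul α
    have hA2 : Integrable (fun s : ℝ => (1/2:ℝ) • (Real.exp (-(s / 2)) • rotZL (-(α * s)))
          (heatExtension F (1 - Real.exp (-s)) ((Real.exp (-(s / 2)) • rotZL (α * s)) y)))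
        (volume.restrict (Ioi (0:ℝ))) := hV.smul (1/2:ℝ)
    have hA3 : Integrable (fun s : ℝ => (1/2:ℝ) • fderiv ℝ (fun z => (Real.exp (-(s / 2)) • rotZL (-(α * s)))
          (heatExtension F (1 - Real.exp (-s)) ((Real.exp (-(s / 2)) • rotZL (α * s)) z))) y y)
        (volume.restrict (Ioi (0:ℝ))) := (hDv y).smul (1/2:ℝ)
    have hA12 : Integrable (fun s : ℝ => α • (rotGenL ((Real.exp (-(s / 2)) • rotZL (-(α * s)))
          (heatExtension F (1 - Real.exp (-s)) ((Real.exp (-(s / 2)) • rotZL (α * s)) y))) -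
        fderiv ℝ (fun z => (Real.exp (-(s / 2)) • rotZL (-(α * s)))
          (heatExtension F (1 - Real.exp (-s)) ((Real.exp (-(s / 2)) • rotZL (α * s)) z))) y (rotGenL y)) +
      (1/2:ℝ) • (Real.exp (-(s / 2)) • rotZL (-(α * s)))
          (heatExtension F (1 - Real.exp (-s)) ((Real.exp (-(s / 2)) • rotZL (α * s)) y)))
        (volume.restrict (Ioi (0:ℝ))) := hA1.add hA2
    have hA123 : Integrable (fun s : ℝ => α • (rotGenL ((Real.exp (-(s / 2)) • rotZL (-(α * s)))
          (heatExtension F (1 - Real.exp (-s)) ((Real.exp (-(s / 2)) • rotZL (α * s)) y))) -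
        fderiv ℝ (fun z => (Real.exp (-(s / 2)) • rotZL (-(α * s)))
          (heatExtension F (1 - Real.exp (-s)) ((Real.exp (-(s / 2)) • rotZL (α * s)) z))) y (rotGenL y)) +
      (1/2:ℝ) • (Real.exp (-(s / 2)) • rotZL (-(α * s)))
          (heatExtension F (1 - Real.exp (-s)) ((Real.exp (-(s / 2)) • rotZL (α * s)) y)) +
      (1/2:ℝ) • fderiv ℝ (fun z => (Real.exp (-(s / 2)) • rotZL (-(α * s)))
          (heatExtension F (1 - Real.exp (-s)) ((Real.exp (-(s / 2)) • rotZL (α * s)) z))) y y)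
        (volume.restrict (Ioi (0:ℝ))) := hA12.add hA3
    rw [hint, integral_sub hA123 hΔ, integral_add hA12 hA3, integral_add hA1 hA2,
      integral_smul, integral_smul, integral_smul, integral_sub hJV (hDv (rotGenL y)),
      integral_finsetSum _ (fun i _ => hD2i i)]
  have hsum : ∑ i : Fin 3, fderiv ℝ (fderiv ℝ (fun y => ∫ s in Ioi (0:ℝ), (Real.exp (-(s / 2)) • rotZL (-(α * s)))
        (heatExtension F (1 - Real.exp (-s)) ((Real.exp (-(s / 2)) • rotZL (α * s)) y)))) y
        (EuclideanSpace.basisFun (Fin 3) ℝ i) (EuclideanSpace.basisFun (Fin 3) ℝ i) =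
      ∑ i : Fin 3, ∫ s in Ioi (0:ℝ), fderiv ℝ (fderiv ℝ (fun z => (Real.exp (-(s / 2)) • rotZL (-(α * s)))
        (heatExtension F (1 - Real.exp (-s)) ((Real.exp (-(s / 2)) • rotZL (α * s)) z)))) y
          (EuclideanSpace.basisFun (Fin 3) ℝ i) (EuclideanSpace.basisFun (Fin 3) ℝ i) :=
    Finset.sum_congr rfl fun i _ => hD2apply i
  have hD1y : fderiv ℝ (fun y => ∫ s in Ioi (0:ℝ), (Real.exp (-(s / 2)) • rotZL (-(α * s)))
        (heatExtension F (1 - Real.exp (-s)) ((Real.exp (-(s / 2)) • rotZL (α * s)) y))) y =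
      ∫ s in Ioi (0:ℝ), fderiv ℝ (fun z => (Real.exp (-(s / 2)) • rotZL (-(α * s)))
        (heatExtension F (1 - Real.exp (-s)) ((Real.exp (-(s / 2)) • rotZL (α * s)) z))) y :=
    (hasFDerivAt_freeResolvent_of_dominated hF h0 hb₁ hD1 y).fderiv
  rw [key, lerayLin_zero_base_eq, hsum, hD1y, ContinuousLinearMap.integral_apply hD, ContinuousLinearMap.integral_apply hD,
    ← rotGenL.integral_comp_comm hV]

/-- **The free resolvent of dominated continuous data solves `𝓛_(α,0) W = F`.** -/
theorem lerayLin_freeResolvent_eq_of_dominated (hF : Continuous F) (h0 : ∀ z, ‖F z‖ ≤ C₀)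
    (hb₁ : IntegrableOn b₁ (Ioi 0))
    (hD1 : ∀ s, 0 < s → ∀ y, ‖fderiv ℝ (fun z => (Real.exp (-(s / 2)) • rotZL (-(α * s)))
        (heatExtension F (1 - Real.exp (-s)) ((Real.exp (-(s / 2)) • rotZL (α * s)) z))) y‖ ≤ b₁ s)
    (hb₂ : IntegrableOn b₂ (Ioi 0))
    (hD2 : ∀ s, 0 < s → ∀ y, ‖fderiv ℝ (fun z => fderiv ℝ (fun z => (Real.exp (-(s / 2)) • rotZL (-(α * s)))
        (heatExtension F (1 - Real.exp (-s)) ((Real.exp (-(s / 2)) • rotZL (α * s)) z))) z) y‖ ≤ b₂ s)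
    (y : EuclideanSpace ℝ (Fin 3)) :
    lerayLin α (fun _ => 0) (fun y => ∫ s in Ioi (0:ℝ), (Real.exp (-(s / 2)) • rotZL (-(α * s)))
        (heatExtension F (1 - Real.exp (-s)) ((Real.exp (-(s / 2)) • rotZL (α * s)) y))) y = F y := by
  rw [lerayLin_freeResolvent_of_dominated hF h0 hb₁ hD1 hb₂ hD2 y,
    integral_lerayLin_freeSlice_of_dominated hF h0 hb₁ hD1 hb₂ hD2 y]

end Dominated

end Summit.NavierStokesRegularity.NavierStokesRegularity.Theorems.KelvinGate

end
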